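import Mathlib
import Summits.CriticalPhenomena.SAWScalingLimit.Theorems.SAWDefectDecoherenceDefectDecoherenceSsReduction
import Summits.CriticalPhenomena.SAWScalingLimit.Theorems.SAWDevelopingMapObservableToSLEShortChordLocalityHelpers
import Summits.CriticalPhenomena.SAWScalingLimit.Theorems.SAWDevelopingMapNoFoldBoundSourceLoopReduction
import Summits.CriticalPhenomena.SAWScalingLimit.Theorems.SAWDevelopingMapPotentialExistsExtension
import HarnessLib

/-!
# Tip return loops: domain monotonicity, reversal symmetry, and the equivalence with the
# source-loop sums (helpers for the stub `stub_tipReturnLoopBound` of the line `sector-slaving`,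
# crux `DefectDecoherence`, stmt-CriticalPhenomena-8549)

The registered stub `stub_tipReturnLoopBound` asks for a UNIFORM bound `N ≤ 8` on the `x_c`-mass
`L_{Λ'}(t; q, s) := Σ_{τ ⊂ Λ' : {t,q} → {s,t}} x_c^{ℓ(τ)}` of the self-avoiding RETURN LOOPS at an
exterior tip `t ∉ Λ'` (interior neighbours `q ≠ s`) of a simply connected hexagonal domain `Λ'`.
As mathematics this is a uniform bound on a critical rooted self-avoiding-polygon series (closing
`τ` through `t` gives a polygon through `t`); its only known supplier in the tree is the open item
`SAWDevelopingMap.SourceLoopBound` (stmt-CriticalPhenomena-8300, `ss_tipReturnLoopBound_of_sourceLoopBound`).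
This file records the exact structural facts about `L_{Λ'}(t; q, s)` that any proof will use:

* `ss_walkMass_mono` — **domain monotonicity (restriction property)** of the `x`-mass of the walks
  between two given mid-edges, `Λ₁ ⊆ Λ₂ ⟹ Σ_{γ ⊂ Λ₁ : a → z} x^ℓ ≤ Σ_{γ ⊂ Λ₂ : a → z} x^ℓ` for
  `x ≥ 0` (the walks of `Λ₁` are, with the same vertex list, walks of `Λ₂`; no side condition is
  needed because `hexDomainMidEdges` is monotone in the vertex set — tree lemma
  `ObservableToSLE.FloorRatio.sum_verts_le_of_subset`);
* `ss_tipReturnLoop_mono` — the specialisation to the tip return-loop mass: `L_{Λ₁}(t;q,s) ≤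
  L_{Λ₂}(t;q,s)` for `Λ₁ ⊆ Λ₂`.  Consequently the supremum in the stub is a supremum over
  MAXIMAL admissible domains: every `(Λ', t)` embeds into a large ball slit along an exterior path
  from `t` (the complement of `Λ'` is connected and infinite), i.e. into a lattice approximation of a
  SLIT PLANE with the tip at the end of the slit — the worst case of the bound;
* `ss_tipReturnLoop_symm` — **reversal symmetry** `L_{Λ'}(t; q, s) = L_{Λ'}(t; s, q)` (reverse the
  walk; tree lemma `PickHalfPlane.Identification.hexParafermionicObservable_zero_symm`);
* `ss_sourceLoop_le_of_tipReturnLoopBound` — the CONVERSE of the reduction in `…SsReduction`: a tip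
  return-loop bound `N` bounds the source-loop sums of stmt-8300 (`Σ` over the walks of `Λ ∖ v` from
  `{v,w₁}` to `{v,w₂}`, `v` a boundary vertex of a simply connected `Λ`) by the same `N`
  (`Λ' := Λ.erase v` is simply connected, `PotentialExists.simplyConnected_erase`);
* `ss_tipReturnLoopBound_iff_sourceLoopBound_eight` — hence the stub is EQUIVALENT to
  "`SourceLoopBound` with its constant `c < sin(π/8)` relaxed to `N ≤ 8`": the two suprema are the
  same number (numerically `≈ 0.12`), only the required constant differs.

Sources: H. Duminil-Copin, S. Smirnov, Ann. of Math. 175 (2012) (arXiv:1007.0575), §1–§2 (walks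
between mid-edges, domains); G. Lawler, O. Schramm, W. Werner, *On the scaling limit of planar
self-avoiding walk* (2004), §3.4 (restriction property); N. Madras, G. Slade, *The Self-Avoiding
Walk* (1993), §1.2 (reversal).  No new definitions.
-/

noncomputable section

open scoped BigOperators ComplexConjugate Classical
open Literature.Probability.LatticeModels Literature.Probability.RandomPlanarGeometry.SAW
open Summit.CriticalPhenomena.SAWScalingLimit.Theorems.DefectDecoherence.TipMartingale

namespace Summit.CriticalPhenomena.SAWScalingLimit.Theorems.DefectDecoherence.SectorSlaving

/-! ### Domain monotonicity -/

/-- **Domain monotonicity of walk masses (restriction property).**  For `Λ₁ ⊆ Λ₂`, any two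
mid-edges `a`, `z` and any fugacity `x ≥ 0`,
`Σ_{γ ⊂ Λ₁ : a → z} x^{ℓ(γ)} ≤ Σ_{γ ⊂ Λ₂ : a → z} x^{ℓ(γ)}`: the self-avoiding walks of the smaller
domain are, with the same vertex list, self-avoiding walks of the larger one (an injection
`HexMidEdgeSAW Λ₁ a z → HexMidEdgeSAW Λ₂ a z`; the field `fst_mem` transfers because
`hexDomainMidEdges` is monotone in the vertex set), and the weights are nonnegative.
[cite: LawlerSchrammWerner2004SAW, §3.4 ("SAW satisfies restriction")] -/
theorem ss_walkMass_mono : ∀ {Λ₁ Λ₂ : Finset HexVertex} (a z : Sym2 HexVertex) {x : ℝ}, 0 ≤ x →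
    Λ₁ ⊆ Λ₂ → (∑ γ : HexMidEdgeSAW Λ₁ a z, x ^ γ.length) ≤ ∑ γ : HexMidEdgeSAW Λ₂ a z, x ^ γ.length := by
  intro Λ₁ Λ₂ a z x hx h
  exact ObservableToSLE.FloorRatio.sum_verts_le_of_subset h a z (fun l => x ^ l.length)
    fun _ => pow_nonneg hx _

/-- **The tip return-loop mass is monotone in the domain**: for `Λ₁ ⊆ Λ₂` and any vertices
`t, q, s`, `Σ_{τ ⊂ Λ₁ : {t,q} → {s,t}} x_c^{ℓ(τ)} ≤ Σ_{τ ⊂ Λ₂ : {t,q} → {s,t}} x_c^{ℓ(τ)}`.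
Consequence for the stub `stub_tipReturnLoopBound`: the supremum of the return-loop masses over
simply connected domains with tip `t` is attained along MAXIMAL ones — large balls slit along an
exterior path from `t`, i.e. lattice slit planes with the tip at the end of the slit.
[cite: LawlerSchrammWerner2004SAW, §3.4 ("SAW satisfies restriction")] -/
theorem ss_tipReturnLoop_mono : ∀ {Λ₁ Λ₂ : Finset HexVertex} (t q s : HexVertex), Λ₁ ⊆ Λ₂ →
    (∑ τ : HexMidEdgeSAW Λ₁ s(t, q) s(s, t), xc ^ τ.length) ≤
      ∑ τ : HexMidEdgeSAW Λ₂ s(t, q) s(s, t), xc ^ τ.length := by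
  intro Λ₁ Λ₂ t q s h
  exact ss_walkMass_mono s(t, q) s(s, t) hexCriticalFugacity_pos_lt_one.1.le h

/-! ### Reversal symmetry -/

/-- **Reversal symmetry of the tip return-loop mass**: for interior neighbours `q, s ∈ Λ'` of `t`
and any fugacity `x`, `Σ_{τ ⊂ Λ' : {t,q} → {s,t}} x^{ℓ(τ)} = Σ_{τ ⊂ Λ' : {t,s} → {q,t}} x^{ℓ(τ)}`
(reverse the list of visited vertices: a length-preserving bijection; both end mid-edges are
mid-edges of the domain). [cite: MadrasSlade1993, §1.2 (reversal symmetry of `c_N(x, y)`)] -/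
theorem ss_tipReturnLoop_symm : ∀ (Λ' : Finset HexVertex) (t q s : HexVertex) (x : ℝ), q ∈ Λ' → s ∈ Λ' →
    hexGraph.Adj t q → hexGraph.Adj t s →
    (∑ τ : HexMidEdgeSAW Λ' s(t, q) s(s, t), x ^ τ.length) =
      ∑ τ : HexMidEdgeSAW Λ' s(t, s) s(q, t), x ^ τ.length := by
  intro Λ' t q s x hq hs htq hts
  have hqm : s(t, q) ∈ hexDomainMidEdges Λ' :=
    ⟨(SimpleGraph.mem_edgeSet hexGraph).2 htq, q, Sym2.mem_mk_right _ _, hq⟩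
  have hsm : s(s, t) ∈ hexDomainMidEdges Λ' :=
    ⟨(SimpleGraph.mem_edgeSet hexGraph).2 hts.symm, s, Sym2.mem_mk_left _ _, hs⟩
  have h := PickHalfPlane.Identification.hexParafermionicObservable_zero_symm Λ' s(t, q) s(s, t)
    hqm hsm x
  rw [hexParafermionicObservable_zero_spin, hexParafermionicObservable_zero_spin] at h
  have h' : (∑ τ : HexMidEdgeSAW Λ' s(t, q) s(s, t), x ^ τ.length) =
      ∑ τ : HexMidEdgeSAW Λ' s(s, t) s(t, q), x ^ τ.length := by
    exact_mod_cast h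
  rw [h', Sym2.eq_swap (a := s) (b := t), Sym2.eq_swap (a := t) (b := q)]

/-! ### The tip return-loop sums are the source-loop sums of stmt-CriticalPhenomena-8300 -/

/-- **A tip return-loop bound `N` gives the source-loop bound of stmt-CriticalPhenomena-8300 with the
same constant `N`**: for a simply connected `Λ`, a boundary vertex `v ∈ Λ` (`v ∼ u ∉ Λ`) and two
further neighbours `w₁ ≠ w₂` of `v`, the `x_c`-mass of the walks of `Λ ∖ v` from `{v,w₁}` to `{v,w₂}`
is at most `N` — apply the tip bound to `Λ' := Λ.erase v` (simply connected), tip `v`, `q := w₁`,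
`s := w₂` (`PotentialExists.simplyConnected_erase`); if `w₁ ∉ Λ` or `w₂ ∉ Λ` there are no such
walks (`SAWDevelopingMapNoFoldBound.isEmpty_saw_of_notMem{_fst}`). (Converse of
`ss_tipReturnLoopBound_of_sourceLoopBound`.) [folklore] -/
theorem ss_sourceLoop_le_of_tipReturnLoopBound : ∀ N : ℝ, 0 ≤ N →
    (∀ (Λ' : Finset HexVertex), hexDomainSimplyConnected Λ' → ∀ (t q s : HexVertex), t ∉ Λ' → q ∈ Λ' →
      s ∈ Λ' → hexGraph.Adj t q → hexGraph.Adj t s → q ≠ s →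
        (∑ τ : HexMidEdgeSAW Λ' s(t, q) s(s, t), xc ^ τ.length) ≤ N) →
    ∀ (Λ : Finset HexVertex), hexDomainSimplyConnected Λ → ∀ u v w₁ w₂ : HexVertex, u ∉ Λ → v ∈ Λ →
      hexGraph.Adj v u → hexGraph.Adj v w₁ → hexGraph.Adj v w₂ → u ≠ w₁ → u ≠ w₂ → w₁ ≠ w₂ →
        (∑ γ : HexMidEdgeSAW (Λ.erase v) s(v, w₁) s(v, w₂), xc ^ γ.length) ≤ N := by
  intro N hN0 hN Λ hΛ u v w₁ w₂ hu _ hvu h₁ h₂ _ _ h₁₂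
  have hv' : v ∉ Λ.erase v := fun h => (Finset.mem_erase.1 h).1 rfl
  by_cases hw₁ : w₁ ∈ Λ
  · by_cases hw₂ : w₂ ∈ Λ
    · have key := hN (Λ.erase v) (PotentialExists.simplyConnected_erase hΛ hu hvu) v w₁ w₂ hv'
        (Finset.mem_erase.2 ⟨h₁.ne.symm, hw₁⟩) (Finset.mem_erase.2 ⟨h₂.ne.symm, hw₂⟩) h₁ h₂ h₁₂
      rwa [Sym2.eq_swap (a := w₂) (b := v)] at key
    · have hne : s(v, w₁) ≠ s(v, w₂) := by
        rw [Ne, Sym2.eq_iff]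
        rintro (⟨-, h⟩ | ⟨h, -⟩)
        · exact h₁₂ h
        · exact h₂.ne h
      haveI := SAWDevelopingMapNoFoldBound.isEmpty_saw_of_notMem (a := s(v, w₁)) hv'
        (fun h => hw₂ (Finset.mem_of_mem_erase h)) hne
      simp [hN0]
  · haveI := SAWDevelopingMapNoFoldBound.isEmpty_saw_of_notMem_fst (z := s(v, w₂)) hv'
      (fun h => hw₁ (Finset.mem_of_mem_erase h))
    simp [hN0]

/-- **The stub is `SourceLoopBound` with the constant relaxed to `8`.**  The registered statement
of `stub_tipReturnLoopBound` (a bound `N ∈ [0, 8]` on the tip return-loop masses of all simply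
connected domains) is EQUIVALENT to the statement of stmt-CriticalPhenomena-8300 with its constant
`c < sin(π/8)` replaced by `N ∈ [0, 8]`: `→` is `ss_sourceLoop_le_of_tipReturnLoopBound`; `←`
inserts the tip (`ss_simplyConnected_insert_tip`, the tip has an exterior neighbour
`ss_exists_ext_nbr`) exactly as in `ss_tipReturnLoopBound_of_sourceLoopBound`.  So the two items
have the same supremum; only the constant they require differs. [folklore] -/
theorem ss_tipReturnLoopBound_iff_sourceLoopBound_eight :
    (∃ N : ℝ, 0 ≤ N ∧ N ≤ 8 ∧
      ∀ (Λ' : Finset HexVertex), hexDomainSimplyConnected Λ' → ∀ (t q s : HexVertex), t ∉ Λ' → q ∈ Λ' →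
        s ∈ Λ' → hexGraph.Adj t q → hexGraph.Adj t s → q ≠ s →
          (∑ τ : HexMidEdgeSAW Λ' s(t, q) s(s, t), xc ^ τ.length) ≤ N) ↔
    (∃ N : ℝ, 0 ≤ N ∧ N ≤ 8 ∧
      ∀ (Λ : Finset HexVertex), hexDomainSimplyConnected Λ → ∀ u v w₁ w₂ : HexVertex, u ∉ Λ → v ∈ Λ →
        hexGraph.Adj v u → hexGraph.Adj v w₁ → hexGraph.Adj v w₂ → u ≠ w₁ → u ≠ w₂ → w₁ ≠ w₂ →
          (∑ γ : HexMidEdgeSAW (Λ.erase v) s(v, w₁) s(v, w₂), xc ^ γ.length) ≤ N) := by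
  constructor
  · rintro ⟨N, hN0, hN8, hN⟩
    exact ⟨N, hN0, hN8, ss_sourceLoop_le_of_tipReturnLoopBound N hN0 hN⟩
  · rintro ⟨N, hN0, hN8, h⟩
    refine ⟨N, hN0, hN8, ?_⟩
    intro Λ' hΛ t q s ht hq hs htq hts hqs
    obtain ⟨r, htr, hr, hrq, hrs⟩ := ss_exists_ext_nbr hΛ ht hq hs
    have key := h (insert t Λ') (ss_simplyConnected_insert_tip hΛ ht hq hs htq hts hqs) r t q s
      (by simp [hr, htr.ne.symm]) (Finset.mem_insert_self t Λ') htr htq hts hrq hrs hqs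
    rwa [Finset.erase_insert ht, Sym2.eq_swap (a := t) (b := s)] at key

end Summit.CriticalPhenomena.SAWScalingLimit.Theorems.DefectDecoherence.SectorSlaving

end
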